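import Summits.BirchSwinnertonDyer.Rank1Residual.JET.KolyvaginClassSignUnconditional
import Literature.NumberTheory.EllipticCurves.McCallum1991.KolyvaginClassesLocalLeaves
import HarnessLib

/-!
# Route `KolyvaginDepthDoor`, crux `KolyvaginDepthSupply` (stmt-BirchSwinnertonDyer-21765) —
# LEAF 1 OF THE hF-FREE DOOR DISCHARGED: the sign law `McCallum1991.sign_conjAct_kolyvaginClass`
# (Gross 1991 Prop. 5.4 (2) / McCallum 1991 §5) HOLDS, unconditionally

Helper file (`--supports stmt-BirchSwinnertonDyer-21765 --as helper`); it closes nothing and BSD is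
not proved by it.

The per-curve door of this route (`…KolyvaginDepthSupplyDoorOfDatum`,
`shaCorank_eq_zero_of_kolyvaginClass_ne_zero_of_rank_le_of_datum`) and every `…OfDatum` row carry FIVE
named McCallum / Gross leaves as hypotheses, the first of which is the sign law
`Literature.NumberTheory.EllipticCurves.McCallum1991.sign_conjAct_kolyvaginClass` (file
`McCallum1991/KolyvaginClassesLocalLeaves`, recorded "Size M; no `_holds`"): for the tree's concrete
classes `c_M(n) = d.kolyvaginClass _ M` of ANY datum `d` of square-free conductor `n` all of whose
prime factors are Zhang–Kolyvagin primes of index `≥ M`, `τ_* c_M(n) = ε (−1)^{ν(n)} c_M(n)` for ONE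
sign `ε = ±1` of the curve.

This is a THEOREM of the tree, proved by another cell for another purpose and never imported by this
route: `Summit.BirchSwinnertonDyer.Rank1Residual.JET.sign_conjAct_kolyvaginClass` (cell `bsd-jet`,
road K; Gross Prop. 5.3 at every conductor prime to `N` via
`JET.exists_mem_ringClassGal_isOfFinAddOrder_conj_sub_smul` = x11b3's `KolyvaginA53.h53_of_recM` with
Shimura reciprocity at conductor `m`, then x11b3's `conjAct_kolyvaginClass_eq_sign_smul_zhang`), with
the EXPLICIT sign `ε = −w(E)` (minus the global root number), in exactly the leaf's currency (Zhang's
congruence form of Kolyvagin primes, `k ≤ M(ℓ)`, any datum, any level `k ≥ 1`). Its hypotheses are a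
subset of the leaf's binders (`ρ̄_{E,p}` onto = the leaf's tower surjectivity at `n = 1`; the leaf's
`¬ CM` is not needed).

* `sign_conjAct_kolyvaginClass_holds` — **`McCallum1991.sign_conjAct_kolyvaginClass` holds.**
* `sign_conjAct_kolyvaginClass_rootNumber` — the same with the sign NAMED: `ε = −W.rootNumber`.

Consequence for the route (accounting only): the binder `h54` of the `…OfDatum` door / kits / rows
is dischargeable by `sign_conjAct_kolyvaginClass_holds`; four named leaves remain (Lemma 4.3,
Prop. 4.4, Lemma 5.3, Prop. 2.2). Nothing is asserted about any curve; BSD is not proved by it.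

References: [GrossLMS1991] §5 (5.2), Prop. 5.3, Prop. 5.4 (p. 243); [McCallumLMS1991] §5 (p. 303);
[WZhang2014] Notations (xii).
-/

set_option linter.dupNamespace false

noncomputable section

open scoped Classical

namespace Summit.BirchSwinnertonDyer.BirchSwinnertonDyer.Theorems.KolyvaginDepthDoor

open Literature.NumberTheory.EllipticCurves Literature.NumberTheory.EllipticCurves.ModularForms
  Literature.NumberTheory.EllipticCurves.McCallum1991 WeierstrassCurve NumberField

/-- **The sign law with the sign named: `τ_* c_M(n) = (−w(E))·(−1)^{ν(n)} · c_M(n)`** for the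
concrete class of ANY datum `d` of square-free conductor `n` whose prime factors are Zhang–Kolyvagin
primes of index `≥ M ≥ 1`, `E/ℚ` globally minimal with `ρ̄_{E,p}` onto at an odd `p`, `K` imaginary
quadratic with `d_K ∉ {−3, −4}` and the Heegner hypothesis for `N_E`, `c` the non-trivial element of
`Aut(K/ℚ)` — the tree theorem `JET.sign_conjAct_kolyvaginClass` (Gross 1991 Prop. 5.4 (1) for the
concrete class, unconditional), re-exported in this route's namespace.
[cite: GrossLMS1991, §5 Prop. 5.3, Prop. 5.4 (p. 243)] [cite: WZhang2014, Notations (xii)] -/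
theorem sign_conjAct_kolyvaginClass_rootNumber
    (W : WeierstrassCurve ℚ) [W.IsElliptic] [W.IsGloballyMinimal] [NeZero (W.conductorNorm ℤ)]
    (K : Type) [Field K] [NumberField K] (hK : IsImaginaryQuadratic K)
    (hD3 : NumberField.discr K ≠ -3) (hD4 : NumberField.discr K ≠ -4)
    (hH : SatisfiesHeegnerHypothesis (W.conductorNorm ℤ) K)
    (p : ℕ) [Fact p.Prime] (hp2 : p ≠ 2) (hρ : W.HasSurjectiveModNGaloisRep p)
    (c : K ≃ₐ[ℚ] K) (hc : c ≠ 1)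
    (Dt : ModularParametrizationData W (W.conductorNorm ℤ)) (β : ℤ) (ι : K →+* ℂ)
    {M : ℕ} (hM : 1 ≤ M) {n : ℕ} (hn : Squarefree n)
    (hk : ∀ l' ∈ n.primeFactors, Zhang2014.IsKolyvaginPrime (W.conductorNorm ℤ) W K p l' ∧
      M ≤ Zhang2014.kolyvaginIndex W p l')
    (d : KolyvaginHeegnerData Dt β ι n) :
    conjAct W c ((p ^ M : ℕ) : ℤ) (d.kolyvaginClass (Fact.out : p.Prime) M) =
      (-W.rootNumber * (-1) ^ n.primeFactors.card) • d.kolyvaginClass (Fact.out : p.Prime) M :=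
  (Summit.BirchSwinnertonDyer.Rank1Residual.JET.sign_conjAct_kolyvaginClass hK hD3 hD4 hH hp2 hρ c hc
    Dt β ι hn hM hk d).2

/-- **LEAF 1 DISCHARGED: `McCallum1991.sign_conjAct_kolyvaginClass` HOLDS** (Gross 1991 Prop. 5.4 (2)
/ McCallum 1991 §5: the class `c_M(n)` lies in the `ε(−1)^{ν(n)}`-eigenspace of complex conjugation,
ONE sign `ε = ±1` for the curve — here `ε = −w(E)`). Proof: the tree theorem
`JET.sign_conjAct_kolyvaginClass` at every square-free Zhang–Kolyvagin level, the leaf's tower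
surjectivity read at `n = 1`. Unconditional; the leaf's `¬ CM` binder is idle.
[cite: GrossLMS1991, §5 Prop. 5.4 (2) (p. 243)] [cite: McCallumLMS1991, §5 (p. 303)] -/
theorem sign_conjAct_kolyvaginClass_holds : sign_conjAct_kolyvaginClass := by
  intro W _ _ _ _hcm K _ _ hK hD3 hD4 hH p _ hp2 htower c hc Dt β ι M hM
  have hρ : W.HasSurjectiveModNGaloisRep p := by simpa only [pow_one] using htower 1
  refine ⟨-W.rootNumber, ?_, fun n hn hk d ↦
    sign_conjAct_kolyvaginClass_rootNumber W K hK hD3 hD4 hH p hp2 hρ c hc Dt β ι hM hn hk d⟩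
  rcases W.rootNumber_eq_one_or with h | h <;> simp [h]

end Summit.BirchSwinnertonDyer.BirchSwinnertonDyer.Theorems.KolyvaginDepthDoor

end
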